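import Mathlib
import Literature.Probability.Percolation.PercolationProofs
import Literature.Probability.LatticeModels.ProdBernoulliIndependence
import Literature.Probability.LatticeModels.ProdBernoulliCoupling
import Literature.Probability.Percolation.KozmaNitzanPinning
import Summits.CriticalPhenomena.PercolationContinuityZ3.Theorems.PercNearOneGluingAdditiveGluingQuantLemma5
import Summits.CriticalPhenomena.PercolationContinuityZ3.Theorems.PercNearOneGluingAdditiveGluingLemma5AnyRelay
import HarnessLib

/-!
# `NoHeavyLowerTail` (stmt-CriticalPhenomena-4575), line fat-minority-linear — LOCALISED SLACK at an explored cylinder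

Route task `nh-dp-fatminority` (gen 4).  `μ = prodBernoulli w` on the pairs of `Fin n`.  The tree's quantitative
Kozma–Nitzan Lemma 5 (`gluingLemma5_quant`, from `knLemma3i_sharp` = KN Lemma 3(i) before its final Harris step,
seat xfam-a) charges the slack of an anchor comparison only on `{anchor ↮ block}`.  This file transports it to
the EXPLORED CYLINDERS of `…FatMinorityExplorationGluing`: for explored pairs `F` with pattern `ξ`, a block
`S ∌ b` containing every open explored pair, `c ∈ S`, and `μ₀ = prodBernoulli (pinW w F ∅)` (all explored
pairs deleted) with `μ₀(a↔b) ≤ μ₀(c↔b) + η`: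
`μ₀(a↮c) μ([ξ]_F ∩ {a↔b}) ≤ μ₀(a↮c) μ([ξ]_F ∩ {S↔b}) + η μ([ξ]_F ∩ {a↮c})`  (`exploredBlockGluing_sharp`), and
`μ₀(a↮c) μ([ξ]_F ∩ {o↮b}) ≤ μ₀(a↮c) μ([ξ]_F ∩ {a↮b}) + η μ([ξ]_F ∩ {a↮o})`   (`exploredCluster_notConn_le_sharp`)
when the open explored pairs join `S` to `o`.  USE: a per-leaf slack `η_L` (e.g. the non-attachment defect
`1 − π_x` of gen 3's window, paid additively there) is multiplied by `μ(a↮o | L)/μ₀(a↮c_L) ≤ 1`, and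
`Σ_L μ(L ∩ {a↮o}) ≤ P(a↮b) + P(o↮b)`, so a uniform ratio `≤ θ < 1` is absorbed with constant `(1+θ)/(1−θ)`.
No new definitions.
-/

namespace Summit.CriticalPhenomena.PercolationContinuityZ3.Theorems

open MeasureTheory Set Filter Topology
open Literature.Probability.LatticeModels (prodBernoulli)
open Literature.Probability.Percolation (BondConfig openConn openGraph openEdgeCluster)

noncomputable section
open Classical
open Literature.Probability.LatticeModels Literature.Probability.Percolation

variable {n : ℕ}

/-- **Explored block gluing, localised slack.**  Data as in `exploredBlockGluing` (`F` explored pairs with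
pattern `ξ`, block `S ∌ b` containing both endpoints of every open explored pair, `c ∈ S`, deleted
weighting `μ₀ = prodBernoulli (pinW w F ∅)` with `μ₀(a ↔ b) ≤ μ₀(c ↔ b) + η`).  Then
`μ₀(a ↮ c) · μ([ξ]_F ∩ {a ↔ b}) ≤ μ₀(a ↮ c) · μ([ξ]_F ∩ {S ↔ b}) + η · μ([ξ]_F ∩ {a ↮ c})`.
[cite: KozmaNitzan2024, §3.2 Lemma 5 (p. 13) and Lemma 3(i) (p. 6)] -/
theorem exploredBlockGluing_sharp (w : Sym2 (Fin n) → unitInterval) (F : Finset (Sym2 (Fin n)))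
    (ξ : Set (Sym2 (Fin n))) (S : Finset (Fin n)) (a c b : Fin n) (η : ℝ)
    (hcS : c ∈ S) (hbS : b ∉ S) (hη : 0 ≤ η)
    (hO : ∀ e ∈ F, e ∈ ξ → (∀ x ∈ e, x ∈ S) ∧ ¬ e.IsDiag)
    (hle : (prodBernoulli (pinW w (↑F : Set (Sym2 (Fin n))) ∅)).real (openConn a b) ≤
      (prodBernoulli (pinW w (↑F : Set (Sym2 (Fin n))) ∅)).real (openConn c b) + η) :
    (prodBernoulli (pinW w (↑F : Set (Sym2 (Fin n))) ∅)).real (openConn a c)ᶜ *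
        (prodBernoulli w).real (localCylinder (↑F : Set (Sym2 (Fin n))) ξ ∩ openConn a b) ≤
      (prodBernoulli (pinW w (↑F : Set (Sym2 (Fin n))) ∅)).real (openConn a c)ᶜ *
        (prodBernoulli w).real (localCylinder (↑F : Set (Sym2 (Fin n))) ξ ∩ ⋃ s ∈ S, openConn s b) +
      η * (prodBernoulli w).real (localCylinder (↑F : Set (Sym2 (Fin n))) ξ ∩ (openConn a c)ᶜ) := by
  set w₀ : Sym2 (Fin n) → unitInterval := pinW w (↑F : Set (Sym2 (Fin n))) ∅ with hw₀
  set pin : Sym2 (Fin n) → unitInterval := pinW w (↑F : Set (Sym2 (Fin n))) ξ with hpin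
  set m := (prodBernoulli w₀).real (openConn a c)ᶜ with hm
  have hm0 : 0 ≤ m := measureReal_nonneg
  -- conditioning on the cylinder is pinning
  have hcond : ∀ X : Set (BondConfig (Fin n)),
      (prodBernoulli w).real (localCylinder (↑F : Set (Sym2 (Fin n))) ξ ∩ X) =
        (prodBernoulli w).real (localCylinder (↑F : Set (Sym2 (Fin n))) ξ) *
          (prodBernoulli pin).real X := fun X => by
    rw [Set.inter_comm, hpin]
    exact prodBernoulli_real_inter_localCylinder w F ξ MeasurableSet.of_discrete
  rw [hcond, hcond, hcond]
  set L := (prodBernoulli w).real (localCylinder (↑F : Set (Sym2 (Fin n))) ξ) with hL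
  have hL0 : 0 ≤ L := measureReal_nonneg
  -- the pinned weighting wired along `S` is the deleted weighting glued along `S`
  have hwire_eq : wireW (↑S : Set (Fin n)) pin =
      fun e : Sym2 (Fin n) => if (∀ x ∈ e, x ∈ S) ∧ ¬ e.IsDiag then 1 else w₀ e := by
    funext e
    have hwire : e ∈ wireSet (↑S : Set (Fin n)) ↔ (∀ x ∈ e, x ∈ S) ∧ ¬ e.IsDiag := by
      simp only [wireSet, Set.mem_setOf_eq, Finset.mem_coe]
    by_cases he : (∀ x ∈ e, x ∈ S) ∧ ¬ e.IsDiag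
    · rw [if_pos he, wireW_apply_of_mem _ (hwire.2 he)]
    · rw [if_neg he, wireW_apply_of_not_mem _ fun h => he (hwire.1 h), hpin, hw₀]
      by_cases heF : e ∈ (↑F : Set (Sym2 (Fin n)))
      · have hξ : e ∉ ξ := fun h => he (hO e (Finset.mem_coe.1 heF) h)
        rw [pinW_apply_of_mem_of_not_mem w heF hξ,
          pinW_apply_of_mem_of_not_mem w heF (Set.notMem_empty e)]
      · rw [pinW_apply_of_not_mem w ξ heF, pinW_apply_of_not_mem w ∅ heF]
  -- the quantitative block lemma (tree: `gluingLemma5_quant`) for the deleted weighting, glued along `S`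
  have hquant := gluingLemma5_quant n w₀ S a c b hcS hbS
  have hmax : max ((prodBernoulli w₀).real (openConn a b) - (prodBernoulli w₀).real (openConn c b)) 0 ≤ η :=
    max_le (by linarith) hη
  have hglue : (prodBernoulli w₀).real (openConn a c)ᶜ *
        (prodBernoulli (fun e : Sym2 (Fin n) =>
          if (∀ x ∈ e, x ∈ S) ∧ ¬ e.IsDiag then 1 else w₀ e)).real (openConn a b) ≤
      (prodBernoulli w₀).real (openConn a c)ᶜ *
        (prodBernoulli (fun e : Sym2 (Fin n) =>
          if (∀ x ∈ e, x ∈ S) ∧ ¬ e.IsDiag then 1 else w₀ e)).real (⋃ s ∈ S, openConn s b) +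
      η * (prodBernoulli (fun e : Sym2 (Fin n) =>
          if (∀ x ∈ e, x ∈ S) ∧ ¬ e.IsDiag then 1 else w₀ e)).real (openConn a c)ᶜ := by
    have hmono : (prodBernoulli (fun e : Sym2 (Fin n) =>
          if (∀ x ∈ e, x ∈ S) ∧ ¬ e.IsDiag then 1 else w₀ e)).real (openConn c b) ≤
        (prodBernoulli (fun e : Sym2 (Fin n) =>
          if (∀ x ∈ e, x ∈ S) ∧ ¬ e.IsDiag then 1 else w₀ e)).real (⋃ s ∈ S, openConn s b) :=
      measureReal_mono (fun ω hω => Set.mem_iUnion₂.2 ⟨c, hcS, hω⟩) (measure_ne_top _ _)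
    have h1 := mul_le_mul_of_nonneg_left hmono (measureReal_nonneg :
      0 ≤ (prodBernoulli w₀).real (openConn a c)ᶜ)
    have h2 := mul_le_mul_of_nonneg_right hmax (measureReal_nonneg :
      0 ≤ (prodBernoulli (fun e : Sym2 (Fin n) =>
          if (∀ x ∈ e, x ∈ S) ∧ ¬ e.IsDiag then 1 else w₀ e)).real (openConn a c)ᶜ)
    linarith [hquant]
  rw [← hwire_eq] at hglue
  -- compare pinned and wired probabilities
  have h1 : (prodBernoulli pin).real (openConn a b) ≤
      (prodBernoulli (wireW (↑S : Set (Fin n)) pin)).real (openConn a b) :=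
    prodBernoulli_real_mono_of_isUpperSet (le_wireW _ _) (isUpperSet_openConn a b)
      MeasurableSet.of_discrete
  have h2 : (prodBernoulli (wireW (↑S : Set (Fin n)) pin)).real (⋃ s ∈ S, openConn s b) =
      (prodBernoulli pin).real (⋃ s ∈ S, openConn s b) := by
    have hcS' : c ∈ (↑S : Set (Fin n)) := Finset.mem_coe.2 hcS
    have h1 : ∀ q : Sym2 (Fin n) → unitInterval,
        (prodBernoulli q).real (⋃ s ∈ S, openConn s b) =
          (prodBernoulli q).real (⋃ t ∈ (↑S : Set (Fin n)), openConn b t) := by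
      intro q
      congr 1
      ext ω
      constructor
      · intro h
        obtain ⟨t, ht, hbt⟩ := Set.mem_iUnion₂.1 h
        exact Set.mem_iUnion₂.2 ⟨t, Finset.mem_coe.2 ht, SimpleGraph.Reachable.symm hbt⟩
      · intro h
        obtain ⟨t, ht, hbt⟩ := Set.mem_iUnion₂.1 h
        exact Set.mem_iUnion₂.2 ⟨t, Finset.mem_coe.1 ht, SimpleGraph.Reachable.symm hbt⟩
    rw [h1, h1, ← prodBernoulli_wireW_real_openConn pin _ hcS' b,
      ← prodBernoulli_wireW_real_openConn (wireW _ pin) _ hcS' b, lemma5AnyRelay_wireW_wireW]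
  have h3 : (prodBernoulli (wireW (↑S : Set (Fin n)) pin)).real (openConn a c)ᶜ ≤
      (prodBernoulli pin).real (openConn a c)ᶜ := by
    have h := prodBernoulli_real_mono_of_isUpperSet (le_wireW (↑S : Set (Fin n)) pin)
      (isUpperSet_openConn a c) (MeasurableSet.of_discrete : MeasurableSet (openConn a c))
    rw [measureReal_compl (MeasurableSet.of_discrete : MeasurableSet (openConn a c)),
      measureReal_compl (MeasurableSet.of_discrete : MeasurableSet (openConn a c)),
      probReal_univ, probReal_univ]
    linarith
  rw [h2] at hglue
  -- assemble: multiply the glued inequality by `L ≥ 0`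
  have h4 : m * (prodBernoulli pin).real (openConn a b) ≤
      m * (prodBernoulli pin).real (⋃ s ∈ S, openConn s b) +
        η * (prodBernoulli pin).real (openConn a c)ᶜ := by
    calc m * (prodBernoulli pin).real (openConn a b)
        ≤ m * (prodBernoulli (wireW (↑S : Set (Fin n)) pin)).real (openConn a b) :=
          mul_le_mul_of_nonneg_left h1 hm0
      _ ≤ m * (prodBernoulli pin).real (⋃ s ∈ S, openConn s b) +
            η * (prodBernoulli (wireW (↑S : Set (Fin n)) pin)).real (openConn a c)ᶜ := hglue
      _ ≤ m * (prodBernoulli pin).real (⋃ s ∈ S, openConn s b) +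
            η * (prodBernoulli pin).real (openConn a c)ᶜ := by
          linarith [mul_le_mul_of_nonneg_left h3 hη]
  have h5 := mul_le_mul_of_nonneg_left h4 hL0
  have e1 : m * (L * (prodBernoulli pin).real (openConn a b)) =
      L * (m * (prodBernoulli pin).real (openConn a b)) := by ring
  have e2 : m * (L * (prodBernoulli pin).real (⋃ s ∈ S, openConn s b)) +
      η * (L * (prodBernoulli pin).real (openConn a c)ᶜ) =
      L * (m * (prodBernoulli pin).real (⋃ s ∈ S, openConn s b) +
        η * (prodBernoulli pin).real (openConn a c)ᶜ) := by ring
  rw [e1, e2]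
  exact h5

/-- **Exploration gluing at a vertex, localised slack.**  Data as in `exploredCluster_notConn_le`; if on
the cylinder every vertex of `S` is joined to `o`, then with `μ₀ = prodBernoulli (pinW w F ∅)`:
`μ₀(a ↮ c) · μ([ξ]_F ∩ {o ↮ b}) ≤ μ₀(a ↮ c) · μ([ξ]_F ∩ {a ↮ b}) + η · μ([ξ]_F ∩ {a ↮ o})` —
the slack of an explored leaf is paid only where the anchor is not joined to the observer.
[cite: KozmaNitzan2024, §3.2 Lemma 5 (p. 13) and Lemma 3(i) (p. 6)] -/
theorem exploredCluster_notConn_le_sharp (w : Sym2 (Fin n) → unitInterval)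
    (F : Finset (Sym2 (Fin n))) (ξ : Set (Sym2 (Fin n))) (S : Finset (Fin n)) (o a c b : Fin n)
    (η : ℝ) (hcS : c ∈ S) (hbS : b ∉ S) (hη : 0 ≤ η)
    (hO : ∀ e ∈ F, e ∈ ξ → (∀ x ∈ e, x ∈ S) ∧ ¬ e.IsDiag)
    (hjoin : ∀ ω ∈ localCylinder (↑F : Set (Sym2 (Fin n))) ξ, ∀ s ∈ S, (openGraph ω).Reachable o s)
    (hle : (prodBernoulli (pinW w (↑F : Set (Sym2 (Fin n))) ∅)).real (openConn a b) ≤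
      (prodBernoulli (pinW w (↑F : Set (Sym2 (Fin n))) ∅)).real (openConn c b) + η) :
    (prodBernoulli (pinW w (↑F : Set (Sym2 (Fin n))) ∅)).real (openConn a c)ᶜ *
        (prodBernoulli w).real (localCylinder (↑F : Set (Sym2 (Fin n))) ξ ∩ (openConn o b)ᶜ) ≤
      (prodBernoulli (pinW w (↑F : Set (Sym2 (Fin n))) ∅)).real (openConn a c)ᶜ *
        (prodBernoulli w).real (localCylinder (↑F : Set (Sym2 (Fin n))) ξ ∩ (openConn a b)ᶜ) +
      η * (prodBernoulli w).real (localCylinder (↑F : Set (Sym2 (Fin n))) ξ ∩ (openConn a o)ᶜ) := by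
  set Lset : Set (BondConfig (Fin n)) := localCylinder (↑F : Set (Sym2 (Fin n))) ξ with hLset
  set m := (prodBernoulli (pinW w (↑F : Set (Sym2 (Fin n))) ∅)).real (openConn a c)ᶜ with hm
  have hm0 : 0 ≤ m := measureReal_nonneg
  have hblock := exploredBlockGluing_sharp w F ξ S a c b η hcS hbS hη hO hle
  -- on the cylinder, `{S ↔ b} ⊆ {o ↔ b}` and `{a ↮ c} = {a ↮ o}`
  have hsub : Lset ∩ (⋃ s ∈ S, openConn s b) ⊆ Lset ∩ openConn o b := by
    rintro ω ⟨hωL, hω⟩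
    obtain ⟨s, hs, hsb⟩ := Set.mem_iUnion₂.1 hω
    exact ⟨hωL, SimpleGraph.Reachable.trans (hjoin ω hωL s hs) hsb⟩
  have hac : Lset ∩ (openConn a c)ᶜ ⊆ Lset ∩ (openConn a o)ᶜ := by
    rintro ω ⟨hωL, hω⟩
    refine ⟨hωL, fun hao => hω ?_⟩
    exact SimpleGraph.Reachable.trans hao (hjoin ω hωL c hcS)
  have h1 : (prodBernoulli w).real (Lset ∩ ⋃ s ∈ S, openConn s b) ≤
      (prodBernoulli w).real (Lset ∩ openConn o b) := measureReal_mono hsub (measure_ne_top _ _)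
  have h2 : (prodBernoulli w).real (Lset ∩ (openConn a c)ᶜ) ≤
      (prodBernoulli w).real (Lset ∩ (openConn a o)ᶜ) := measureReal_mono hac (measure_ne_top _ _)
  -- complements inside the cylinder
  have hsplit : ∀ X : Set (BondConfig (Fin n)),
      (prodBernoulli w).real (Lset ∩ Xᶜ) =
        (prodBernoulli w).real Lset - (prodBernoulli w).real (Lset ∩ X) := by
    intro X
    have h := measureReal_inter_add_sdiff (μ := prodBernoulli w) (s := Lset) (t := X)
      (MeasurableSet.of_discrete : MeasurableSet X)
    rw [Set.sdiff_eq] at h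
    linarith
  rw [hsplit (openConn o b), hsplit (openConn a b)]
  have h3 := mul_le_mul_of_nonneg_left h1 hm0
  have h4 := mul_le_mul_of_nonneg_left h2 hη
  nlinarith [hblock, h3, h4, hm0]

end

end Summit.CriticalPhenomena.PercolationContinuityZ3.Theorems
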